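import Mathlib
import Summits.AtomisticToContinuum.Crystallization.Theses.GappedShellCensus
import Summits.AtomisticToContinuum.Crystallization.Theses.HullMinimality
import Summits.AtomisticToContinuum.Crystallization.Theorems.PhononSlackCertificatesPeriodicGivenLayered
import Literature.MathematicalPhysics.StatisticalMechanics.BarlowStacking
import Literature.Geometry.DiscreteGeometry.KissingPatterns

/-!
# Sketch — crux-ideate, crux `GappedShellCensus.CleanLimitsHaveWindows`
(stmt-AtomisticToContinuum-15932), round 1, ideator 1

First lemmas of the three idea cards, typed over existing declarations, plus ONE sorry-free
reduction: `cleanLimitsHaveWindows_of_cleanHullLayered` — the crux follows from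
`CleanHullLayered` (card `free-stacking-transversal-closing`) by the PROVED
`LayeredHull.PeriodicGivenLayered_proof` (stmt-11779).

Nothing here is a skeleton; stubs are `def … : Prop`.
-/

noncomputable section

namespace Summit.AtomisticToContinuum.Crystallization.Cruxes.CleanLimitsHaveWindows.IdeatorOne

open Filter MeasureTheory
open Literature.MathematicalPhysics.StatisticalMechanics
open Literature.Geometry.DiscreteGeometry

/-- Euclidean 3-space. -/
abbrev E3 := EuclideanSpace ℝ (Fin 3)

/-- `S` lies in the (translation / local-limit) hull of the ground-state sequence `x`:
for all `R, ε`, frequently in `N`, some translate of `x N` is two-way `ε`-matched with `S` on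
`B(0,R)`.  This is the hypothesis shape of `LayeredHull.stub_windowBounds` (U) and the conclusion
shape of `HullMinimality.LayeredWindows` / `PeriodicWindows`. -/
def InHull (x : (N : ℕ) → (Fin N → E3)) (S : Set E3) : Prop :=
  ∀ R ε : ℝ, 0 < ε → ∃ᶠ N in atTop, ∃ t : E3,
    (∀ p ∈ S, ‖p‖ ≤ R → ∃ i : Fin N, dist (x N i + t) p ≤ ε) ∧
    (∀ i : Fin N, ‖x N i + t‖ ≤ R → ∃ p ∈ S, dist (x N i + t) p ≤ ε)

/-- The crux's local-limit clause for `Y` (along a subsequence, eventually), verbatim. -/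
def IsSubseqLimit (x : (N : ℕ) → (Fin N → E3)) (Y : Set E3) : Prop :=
  ∃ (φ : ℕ → ℕ) (t : ℕ → E3), StrictMono φ ∧ ∀ R ε : ℝ, 0 < ε → ∀ᶠ n in atTop,
    (∀ y ∈ Y, ‖y‖ ≤ R → ∃ i : Fin (φ n), dist (x (φ n) i + t n) y ≤ ε) ∧
    (∀ i : Fin (φ n), ‖x (φ n) i + t n‖ ≤ R → ∃ y ∈ Y, dist (x (φ n) i + t n) y ≤ ε)

/-- EVERYWHERE CLEAN at scale `a` — the crux's hypothesis on `Y`, verbatim: every site is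
gapped-twelve at `(a, 1/50, 63/50)` with rescaled bond shell `1/5`-close to the fcc or hcp
kissing pattern. -/
def IsClean (a : ℝ) (Y : Set E3) : Prop :=
  ∀ y ∈ Y, ({w ∈ Y | w ≠ y ∧ dist y w ≤ a * (1 + 1 / 50)}.ncard = 12 ∧
      ∀ w ∈ Y, w ≠ y → a * (1 - 1 / 50) ≤ dist y w ∧
        (dist y w ≤ a * (1 + 1 / 50) ∨ a * (63 / 50) ≤ dist y w)) ∧
    ∃ T : Finset E3, (↑T : Set E3) = (fun w => a⁻¹ • (w - y)) '' {w ∈ Y | w ≠ y ∧ dist y w ≤ a * (1 + 1 / 50)} ∧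
      (ShellCloseTo (1 / 5) T fccKissingPattern ∨ ShellCloseTo (1 / 5) T hcpKissingPattern)

/-- The exactly LAYERED set of `HullMinimality.LayeredWindows` (triangular layers of spacing
`a`, hole registry along the Hägg word `s`, FREE heights `z`), moved by the linear isometry `A`. -/
def layeredSet (A : E3 →ₗᵢ[ℝ] E3) (a : ℝ) (s : ℤ → ℤ) (z : ℤ → ℝ) : Set E3 :=
  {p | ∃ m i j : ℤ, p = A (((i : ℝ) • triangularVec₁ a) + ((j : ℝ) • triangularVec₂ a) +
    ((haggLabel s m : ℝ) • barlowOffset a) + (z m • layerNormal 1))}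

/-- UNIFORM RECURRENCE of a point set in the local rubber topology (Baake–Grimm §5.4): every
`(R, ε)`-patch of `Z` reappears, up to `ε`, within distance `G(R, ε)` of every point of space. -/
def UniformlyRecurrent (Z : Set E3) : Prop :=
  ∀ R ε : ℝ, 0 < ε → ∃ G : ℝ, ∀ c : E3, ∃ g : E3, dist g c ≤ G ∧
    (∀ p ∈ Z, ‖p‖ ≤ R → ∃ q ∈ Z, dist (q - g) p ≤ ε) ∧
    (∀ q ∈ Z, ‖q - g‖ ≤ R → ∃ p ∈ Z, dist (q - g) p ≤ ε)

/-! ## Card A — `free-stacking-transversal-closing` -/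

/-- **Card A, the transfer target `CleanHullLayered`.** A clean local limit of a sequence of LJ
ground states has, in its hull, an EXACTLY LAYERED set with in-plane spacing and increments in the
box of `LayeredWindows` (word and heights free). -/
def CleanHullLayered : Prop :=
  ∀ x : (N : ℕ) → (Fin N → E3), (∀ N, IsGroundState lennardJones (x N)) →
    ∀ (Y : Set E3) (a : ℝ), 47 / 50 ≤ a → a ≤ 1 → (0 : E3) ∈ Y → IsSubseqLimit x Y → IsClean a Y →
      ∃ (a' : ℝ) (A : E3 →ₗᵢ[ℝ] E3) (s : ℤ → ℤ) (z : ℤ → ℝ), 47 / 50 ≤ a' ∧ a' ≤ 1 ∧ IsHaggSeq s ∧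
        (∀ m : ℤ, 39 / 50 * a' ≤ z (m + 1) - z m ∧ z (m + 1) - z m ≤ 17 / 20 * a') ∧
        InHull x (layeredSet A a' s z)

/-- **Card A, soft step (recurrence in the clean hull).** The translation hull of a clean hull
element contains a uniformly recurrent element, again clean, again in the hull of `x`
(minimal subsets of the compact hull; Gottschalk; diagonal re-extraction as in
`LayeredHull.stub_recurrence`). -/
def CleanHullRecurrent : Prop :=
  ∀ x : (N : ℕ) → (Fin N → E3), (∀ N, IsGroundState lennardJones (x N)) →
    ∀ (Y : Set E3) (a : ℝ), 0 < a → (0 : E3) ∈ Y → InHull x Y → IsClean a Y →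
      ∃ Z : Set E3, (0 : E3) ∈ Z ∧ InHull x Z ∧ IsClean a Z ∧ UniformlyRecurrent Z

/-- **Card A, FIRST LEMMA (the load-bearing one): `TransversalClosing`.** A uniformly recurrent,
everywhere-clean element of the hull of a ground-state sequence IS an exactly layered set with
parameters in the box.  Mechanism: the landed window bounds (U)/(L) at equal cardinality
(`stub_windowBounds`) against the own-word, vertically relaxed layered reference at the window's
own in-plane spacing — the reference stress is conjugate only to parameters that are FREE in the
layered family, so the first-order term is surface order and transversal coercivity (in-plane,
registry, flatness) prices a recurrent transversal defect linearly in the volume. -/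
def TransversalClosing : Prop :=
  ∀ x : (N : ℕ) → (Fin N → E3), (∀ N, IsGroundState lennardJones (x N)) →
    ∀ (Z : Set E3) (a : ℝ), 47 / 50 ≤ a → a ≤ 1 → Z.Nonempty → InHull x Z → IsClean a Z →
      UniformlyRecurrent Z →
      ∃ (a' : ℝ) (A : E3 →ₗᵢ[ℝ] E3) (s : ℤ → ℤ) (z : ℤ → ℝ) (v : E3), 47 / 50 ≤ a' ∧ a' ≤ 1 ∧
        IsHaggSeq s ∧ (∀ m : ℤ, 39 / 50 * a' ≤ z (m + 1) - z m ∧ z (m + 1) - z m ≤ 17 / 20 * a') ∧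
        Z = (fun p => p + v) '' layeredSet A a' s z

/-! ## Card B — `clean-hull-stationary-law` -/

/-- **Card B, FIRST LEMMA: `HullLaw`.** From ONE clean local limit `Y` of the ground states,
Krylov–Bogolyubov averaging of the rooted translates `Y - y`, `y ∈ Y ∩ B_L`, produces a
point-stationary hard-core probability law carried by CLEAN hull elements of `x`, whose mean site
energy is at most `e* = ⨅ periodic e(Q)` (by the proved `hullBulkOptimal_proof` in mean and the
proved `crysEnergyLimit_proof`) — i.e. a MINIMISING law in the sense of
`PalmUnimodularRigidity.LayeredLawsSelectHcp` (stmt-9226), typed in that item's vocabulary. -/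
def HullLaw : Prop :=
  ∀ x : (N : ℕ) → (Fin N → E3), (∀ N, IsGroundState lennardJones (x N)) →
    ∀ (Y : Set E3) (a : ℝ), 47 / 50 ≤ a → a ≤ 1 → (0 : E3) ∈ Y → InHull x Y → IsClean a Y →
      ∃ P : Measure (Measure E3), IsProbabilityMeasure P ∧
        (∀ᵐ μ ∂P, ∃ S : Set E3, (0 : E3) ∈ S ∧ InHull x S ∧ IsClean a S ∧
          μ = (Measure.count : Measure E3).restrict S) ∧
        (∀ g : Measure E3 → E3 → ENNReal, Measurable (Function.uncurry g) →
          ∫⁻ μ, ∫⁻ y, g μ y ∂μ ∂P = ∫⁻ μ, ∫⁻ y, g (Measure.map (fun z => z - y) μ) (-y) ∂μ ∂P) ∧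
        (∫ μ, (∫ y, lennardJones ‖y‖ ∂μ) / 2 ∂P) ≤
          ⨅ Q : PeriodicConfiguration 3, Q.energyPerParticle lennardJones

/-- **Card B, exit glue (soft).** If a law as in `HullLaw` is a.s. carried by rigid images of an
exact stacking (the conclusion of stmt-9226, or the weaker "a.s. exactly layered"), then some clean
hull element of `x` is an exact layered set — and `InHull` of a layered set is `LayeredWindows`
data, whence the crux by `PeriodicGivenLayered_proof`; with the hcp conclusion of 9226 one may
instead read off `P` directly (pattern of `hullPeriodicCrystallizes`, stmt-12094). -/
def LawSupportExit : Prop :=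
  ∀ x : (N : ℕ) → (Fin N → E3), ∀ (a : ℝ) (P : Measure (Measure E3)), IsProbabilityMeasure P →
    (∀ᵐ μ ∂P, ∃ S : Set E3, (0 : E3) ∈ S ∧ InHull x S ∧ IsClean a S ∧
      μ = (Measure.count : Measure E3).restrict S) →
    (∀ᵐ μ ∂P, ∃ (A : E3 →ₗᵢ[ℝ] E3) (a' : ℝ) (s : ℤ → ℤ) (z : ℤ → ℝ) (v : E3), IsHaggSeq s ∧
      μ = (Measure.count : Measure E3).restrict ((fun p => p + v) '' layeredSet A a' s z)) →
    ∃ (A : E3 →ₗᵢ[ℝ] E3) (a' : ℝ) (s : ℤ → ℤ) (z : ℤ → ℝ), IsHaggSeq s ∧ InHull x (layeredSet A a' s z)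

/-! ## Card C — `hole-completion-combinatorial-chart` -/

/-- **Card C, FIRST LEMMA: `HoleCompletion`.** In an everywhere-clean configuration every bonded
4-cycle `u v w t` of neighbours of a site `y` with OPEN diagonals (an equatorial square of an
octahedral hole) is closed by a sixth vertex: a site `y' ≠ y` bonded to all four — so every
octahedral hole is a complete bond-octahedron (Cauchy-rigid at 2 %), which freezes the jitterbug
twist that is the only source of the census slack `1/5`. -/
def HoleCompletion : Prop :=
  ∀ (Y : Set E3) (a : ℝ), 0 < a → IsClean a Y →
    ∀ y ∈ Y, ∀ u ∈ Y, ∀ v ∈ Y, ∀ w ∈ Y, ∀ t ∈ Y,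
      u ≠ y → v ≠ y → w ≠ y → t ≠ y →
      dist y u ≤ a * (1 + 1 / 50) → dist y v ≤ a * (1 + 1 / 50) →
      dist y w ≤ a * (1 + 1 / 50) → dist y t ≤ a * (1 + 1 / 50) →
      dist u v ≤ a * (1 + 1 / 50) → dist v w ≤ a * (1 + 1 / 50) →
      dist w t ≤ a * (1 + 1 / 50) → dist t u ≤ a * (1 + 1 / 50) →
      a * (63 / 50) ≤ dist u w → a * (63 / 50) ≤ dist v t →
      ∃ y' ∈ Y, y' ≠ y ∧ dist y' u ≤ a * (1 + 1 / 50) ∧ dist y' v ≤ a * (1 + 1 / 50) ∧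
        dist y' w ≤ a * (1 + 1 / 50) ∧ dist y' t ≤ a * (1 + 1 / 50)

/-- **Card C, consequence `LinkComplete`**: in an everywhere-clean configuration the bond graph
restricted to a shell is the FULL cuboctahedral / anticuboctahedral graph — any two neighbours of
`y` are either bonded (`≤ 1.02a`) or at distance `≥ 1.3 a` (extended gap: no neighbour pair in the
annulus `[1.26a, 1.3a)`; the sharp value is the band-octahedron bound `2√(0.98² − 1.02²/2) a = 1.3269 a`),
and exactly 24 neighbour pairs are bonded. -/
def LinkComplete : Prop :=
  ∀ (Y : Set E3) (a : ℝ), 0 < a → IsClean a Y → ∀ y ∈ Y,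
    {p : E3 × E3 | p.1 ∈ Y ∧ p.2 ∈ Y ∧ p.1 ≠ y ∧ p.2 ≠ y ∧ p.1 ≠ p.2 ∧
        dist y p.1 ≤ a * (1 + 1 / 50) ∧ dist y p.2 ≤ a * (1 + 1 / 50) ∧
        dist p.1 p.2 ≤ a * (1 + 1 / 50)}.ncard = 48 ∧
    ∀ u ∈ Y, ∀ w ∈ Y, u ≠ y → w ≠ y → u ≠ w → dist y u ≤ a * (1 + 1 / 50) →
      dist y w ≤ a * (1 + 1 / 50) → (dist u w ≤ a * (1 + 1 / 50) ∨ a * (13 / 10) ≤ dist u w)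

/-- **Card C, transfer target `CleanChart`**: the conclusion of the PROVED
`PalmUnimodularRigidity.ShellsToBarlowChart` (stmt-9227: global Barlow bond-isomorphism), for the
everywhere-clean class at `(1/50, 1/5, 63/50)` instead of `1 %` shells — obtained by running the
growth-descent development on the COMPLETE contact graph delivered by `LinkComplete`. -/
def CleanChart : Prop :=
  ∀ (Y : Set E3) (a : ℝ), 0 < a → Y.Nonempty → IsClean a Y →
    ∃ s : ℤ → ℤ, IsHaggSeq s ∧ ∃ Φ : E3 → E3, Set.BijOn Φ (barlowStacking 1 (Real.sqrt (2 / 3)) s) Y ∧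
      ∀ p ∈ barlowStacking 1 (Real.sqrt (2 / 3)) s, ∀ q ∈ barlowStacking 1 (Real.sqrt (2 / 3)) s,
        (dist p q = 1 ↔ (0 < dist (Φ p) (Φ q) ∧ dist (Φ p) (Φ q) ≤ a * (1 + 1 / 50)))

/-! ## The sorry-free reduction: card A's target implies the crux through the PROVED 11779 -/

/-- `IsSubseqLimit` (eventually along a subsequence) gives `InHull` (frequently). [folklore] -/
theorem inHull_of_isSubseqLimit {x : (N : ℕ) → (Fin N → E3)} {Y : Set E3}
    (h : IsSubseqLimit x Y) : InHull x Y := by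
  obtain ⟨φ, t, hφ, hY⟩ := h
  intro R ε hε
  have hev : ∀ᶠ n in atTop, ∃ t' : E3,
      (∀ y ∈ Y, ‖y‖ ≤ R → ∃ i : Fin (φ n), dist (x (φ n) i + t') y ≤ ε) ∧
      (∀ i : Fin (φ n), ‖x (φ n) i + t'‖ ≤ R → ∃ y ∈ Y, dist (x (φ n) i + t') y ≤ ε) :=
    (hY R ε hε).mono fun n hn => ⟨t n, hn⟩
  exact hφ.tendsto_atTop.frequently hev.frequently

/-- `InHull` is insensitive to translating the set. [folklore] -/
theorem inHull_of_translate {x : (N : ℕ) → (Fin N → E3)} {S : Set E3} (v : E3)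
    (h : InHull x ((fun p => p + v) '' S)) : InHull x S := by
  intro R ε hε
  refine (h (R + ‖v‖) ε hε).mono ?_
  rintro N ⟨t, h1, h2⟩
  have key : ∀ y p : E3, dist (y + (t - v)) p = dist (y + t) (p + v) := fun y p => by
    rw [dist_eq_norm, dist_eq_norm]; congr 1; abel
  refine ⟨t - v, ?_, ?_⟩
  · intro p hp hpR
    have hpv : ‖p + v‖ ≤ R + ‖v‖ := (norm_add_le p v).trans (by linarith)
    obtain ⟨i, hi⟩ := h1 (p + v) ⟨p, hp, rfl⟩ hpv
    exact ⟨i, by rw [key]; exact hi⟩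
  · intro i hi
    have hnorm : ‖x N i + t‖ ≤ R + ‖v‖ := by
      have e : x N i + t = (x N i + (t - v)) + v := by abel
      rw [e]
      exact (norm_add_le _ _).trans (by linarith)
    obtain ⟨q, ⟨p, hp, rfl⟩, hq⟩ := h2 i hnorm
    exact ⟨p, hp, by rw [key]; exact hq⟩

/-- **COMPOSITION (sorry-free): card A's two stubs give its target.**
`CleanHullRecurrent → TransversalClosing → CleanHullLayered`. [folklore] -/
theorem cleanHullLayered_of (hrec : CleanHullRecurrent) (hclo : TransversalClosing) :
    CleanHullLayered := by
  intro x hx Y a ha ha1 h0 hlim hclean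
  have ha0 : 0 < a := by linarith
  obtain ⟨Z, hZ0, hZhull, hZclean, hZrec⟩ :=
    hrec x hx Y a ha0 h0 (inHull_of_isSubseqLimit hlim) hclean
  obtain ⟨a', A, s, z, v, ha', ha'1, hs, hz, hZeq⟩ :=
    hclo x hx Z a ha ha1 ⟨0, hZ0⟩ hZhull hZclean hZrec
  refine ⟨a', A, s, z, ha', ha'1, hs, hz, ?_⟩
  rw [hZeq] at hZhull
  exact inHull_of_translate v hZhull

/-- **REDUCTION (sorry-free).** `CleanHullLayered → CleanLimitsHaveWindows`: feed the layered hull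
element as `LayeredWindows` data into the proved `PeriodicGivenLayered_proof` (stmt-11779).
[folklore] -/
theorem cleanLimitsHaveWindows_of_cleanHullLayered (h : CleanHullLayered) :
    Summit.AtomisticToContinuum.Crystallization.Theses.GappedShellCensus.CleanLimitsHaveWindows := by
  intro x hx Y a ha ha1 h0 hlim hclean
  obtain ⟨a', A, s, z, ha', ha'1, hs, hz, hH⟩ := h x hx Y a ha ha1 h0 hlim hclean
  have hlay : ∃ a : ℝ, 47 / 50 ≤ a ∧ a ≤ 1 ∧ ∀ R ε : ℝ, 0 < ε → ∃ᶠ N in Filter.atTop,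
      ∃ (A : E3 →ₗᵢ[ℝ] E3) (t : E3) (s : ℤ → ℤ) (z : ℤ → ℝ), IsHaggSeq s ∧
        (∀ m : ℤ, 39 / 50 * a ≤ z (m + 1) - z m ∧ z (m + 1) - z m ≤ 17 / 20 * a) ∧
        let S : Set E3 := {p | ∃ m i j : ℤ, p = A (((i : ℝ) • triangularVec₁ a) +
          ((j : ℝ) • triangularVec₂ a) + ((haggLabel s m : ℝ) • barlowOffset a) +
          (z m • layerNormal 1))};
        (∀ p ∈ S, ‖p‖ ≤ R → ∃ i : Fin N, dist (x N i + t) p ≤ ε) ∧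
        (∀ i : Fin N, ‖x N i + t‖ ≤ R → ∃ p ∈ S, dist (x N i + t) p ≤ ε) := by
    refine ⟨a', ha', ha'1, fun R ε hε => ?_⟩
    refine (hH R ε hε).mono ?_
    rintro N ⟨t, ht⟩
    exact ⟨A, t, s, z, hs, hz, ht⟩
  exact Summit.AtomisticToContinuum.Crystallization.Theorems.LayeredHull.PeriodicGivenLayered_proof
    x hx hlay

/-- **Card A end to end (sorry-free composition over its two stubs):**
`CleanHullRecurrent → TransversalClosing → CleanLimitsHaveWindows` — the crux BY NAME. [folklore] -/
theorem cleanLimitsHaveWindows_of_recurrence_closing (hrec : CleanHullRecurrent)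
    (hclo : TransversalClosing) :
    Summit.AtomisticToContinuum.Crystallization.Theses.GappedShellCensus.CleanLimitsHaveWindows :=
  cleanLimitsHaveWindows_of_cleanHullLayered (cleanHullLayered_of hrec hclo)

end Summit.AtomisticToContinuum.Crystallization.Cruxes.CleanLimitsHaveWindows.IdeatorOne

end
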